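import Summits.NavierStokesRegularity.NavierStokesRegularity.Theorems.ExtremiserTransienceTwoThirdsLayerFinal
import Summits.NavierStokesRegularity.NavierStokesRegularity.Theorems.ExtremiserTransienceTwoThirdsCutoffPackage
import Summits.NavierStokesRegularity.NavierStokesRegularity.Theorems.ExtremiserTransienceTwoThirdsReduction
import Summits.NavierStokesRegularity.NavierStokesRegularity.Theorems.ExtremiserTransienceTwoThirdsBallCalculus
import HarnessLib

/-!
# Route `ExtremiserTransience`, crux `NearExtremalTransiencePerFlow` (stmt-NavierStokesRegularity-26567), LINE g10-1 «two_thirds»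
# (ns-idea-10 g10): stub S2 `FirstOrderIdentity` PROVED — Euler–Lagrange-critical fields are 2/3-efficient at infinity

`firstOrderIdentity_holds : FirstOrderIdentity` (texts of record `…TwoThirdsDefs`, REV 1.2 §2 VERBATIM): for `V` in the limit class,
every `D > 0` and `ε > 0` there are `η > 0`, `R₁` such that every `D`-doubling ball `B(c,R)`, `R ≥ R₁`, with `η`-light layer of width
`R^{7/8}` satisfies `|3J_B − κ⋆(Z_B + W_B)| ≤ ε(1 + Z_B + W_B)`.

Proof (assembly of the landed helper files; scale `ρ = R^{1/8}`, `ℓ = ρ⁷ = R^{7/8}`): the reduction identity `three_Jg_sub_two_Kg_eq`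
(Euler–Lagrange on the potential `χψ`, `ψ = K ∗ (ζV)` the truncated Biot–Savart gauge, `χ` the thin-shell weight of `cutoff_package`)
writes `3J_{χ²} − 2K_{χ²}` as the LAYER integral plus the REMAINDER `a₁(χ·(V − curl ψ))`; `layer_bound` gives
`C_Θ·(layer bulk) + C(1 + Z_{B(c,4R)})/ρ`, `remainder_bound` gives `C(1 + Z_{B(c,R+ℓ)} + layer W)/ρ`, `abs_three_Jb_sub_le` compares
weighted and sharp bulks at the cost of the layer bulk; the light layer (`≤ η·bulk`) and doubling (`Z_{B(c,4R)} ≤ D·bulk`) turn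
this into `(C_Θ + 3A₁ + κ⋆)η·bulk + C'(1 + bulk)/ρ`, and `η`, `R₁` are chosen accordingly (`final_arith`).

HONEST FRAMING: S2 is ONE of three stubs of LINE g10-1 (S1a `TypicalSelection` is its open heart); nothing about Navier–Stokes
regularity or blow-up is proved; the crux ⟨26567⟩ and NS regularity are OPEN; no summit is proved by a line. [folklore]
-/

noncomputable section

open scoped Topology InnerProductSpace RealInnerProductSpace ENNReal ContDiff
open MeasureTheory Filter Set Metric
open Literature.Analysis.FluidPDE
open Summit.NavierStokesRegularity.NavierStokesRegularity.Theorems.DepletionLadder.KStar.HalfSpace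
open Summit.NavierStokesRegularity.NavierStokesRegularity.Theorems.DepletionLadder
open Summit.NavierStokesRegularity.NavierStokesRegularity.Theorems.NearExtremalTransiencePerFlow.LocalMaximiser

namespace Summit.NavierStokesRegularity.NavierStokesRegularity.Theorems.NearExtremalTransiencePerFlow.TwoThirds

-- the summit's namespace repeats the problem name by convention (D-0017)
set_option linter.dupNamespace false

/-- The final arithmetic of S2: light layer + doubling + the two `O(1/ρ)` bounds give `ε(1 + bulk)`. [folklore] -/
theorem final_arith {ε η ρ CΘ Clay Crem A₁ D b₁ b₂ ZS WS Z4 LI RB X : ℝ}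
    (hε : 0 < ε) (hCΘ : 0 ≤ CΘ) (hClay : 0 ≤ Clay) (hCrem : 0 ≤ Crem) (hA₁ : 0 ≤ A₁) (hD : 0 ≤ D) (hb₁ : 0 ≤ b₁) (hb₂ : 0 ≤ b₂)
    (hη1 : η ≤ 1) (hηε : η ≤ ε / (2 * (CΘ + 3 * A₁ + kStar + 1))) (hρ0 : 0 < ρ)
    (hρε : 2 * (Clay * (D + 1) + 3 * Crem + 1) / ε ≤ ρ)
    (hZS : b₁ ≤ ZS) (hWS : b₂ ≤ WS) (hlay : (ZS + WS) - (b₁ + b₂) ≤ η * (b₁ + b₂)) (hZ4 : Z4 ≤ D * (b₁ + b₂))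
    (hLI : LI ≤ CΘ * ((ZS - b₁) + (WS - b₂)) + Clay * (1 + Z4) / ρ)
    (hRB : RB ≤ Crem * (1 + ZS + (WS - b₂)) / ρ)
    (hX : X ≤ LI + RB + 3 * (A₁ * (ZS - b₁)) + kStar * ((ZS + WS) - (b₁ + b₂))) :
    X ≤ ε * (1 + b₁ + b₂) := by
  have hK : 0 < kStar := kStar_pos
  set b := b₁ + b₂ with hb
  have hb0 : 0 ≤ b := by rw [hb]; positivity
  have hηb : η * b ≤ b := mul_le_of_le_one_left hb0 hη1
  have hZ1 : ZS - b₁ ≤ η * b := by linarith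
  have hW1 : WS - b₂ ≤ η * b := by linarith
  -- the `O(1/ρ)` part
  set M : ℝ := Clay * (D + 1) + 3 * Crem with hM
  have hM0 : 0 ≤ M := by positivity
  have hnum : Clay * (1 + Z4) + Crem * (1 + ZS + (WS - b₂)) ≤ M * (1 + b) := by
    have u1 : 1 + Z4 ≤ (D + 1) * (1 + b) := by nlinarith
    have u2 : 1 + ZS + (WS - b₂) ≤ 3 * (1 + b) := by linarith
    have v1 := mul_le_mul_of_nonneg_left u1 hClay
    have v2 := mul_le_mul_of_nonneg_left u2 hCrem
    rw [hM]; linarith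
  have hρε' : 2 * (M + 1) ≤ ρ * ε := by
    have h := (div_le_iff₀ hε).1 hρε
    linarith
  have hfrac : (Clay * (1 + Z4) + Crem * (1 + ZS + (WS - b₂))) / ρ ≤ ε / 2 * (1 + b) := by
    rw [div_le_iff₀ hρ0]
    have h1 : M * (1 + b) ≤ ε / 2 * (1 + b) * ρ := by
      have h2 : M ≤ ε / 2 * ρ := by linarith
      have h3 := mul_le_mul_of_nonneg_right h2 (by positivity : (0 : ℝ) ≤ 1 + b)
      linarith
    linarith
  have hsplit : Clay * (1 + Z4) / ρ + Crem * (1 + ZS + (WS - b₂)) / ρ =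
      (Clay * (1 + Z4) + Crem * (1 + ZS + (WS - b₂))) / ρ := by ring
  -- the `η` part
  set S : ℝ := CΘ + 3 * A₁ + kStar with hS
  have hS0 : 0 ≤ S := by positivity
  have hηS : S * η ≤ ε / 2 := by
    have h1 : S * η ≤ S * (ε / (2 * (S + 1))) := mul_le_mul_of_nonneg_left hηε hS0
    have h2 : S * (ε / (2 * (S + 1))) ≤ ε / 2 := by
      rw [mul_div_assoc', div_le_div_iff₀ (by positivity) (by norm_num)]
      nlinarith
    linarith
  have hηpart : CΘ * ((ZS - b₁) + (WS - b₂)) + 3 * (A₁ * (ZS - b₁)) + kStar * ((ZS + WS) - (b₁ + b₂)) ≤ ε / 2 * b := by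
    have u1 : CΘ * ((ZS - b₁) + (WS - b₂)) ≤ CΘ * (η * b) := mul_le_mul_of_nonneg_left (by linarith) hCΘ
    have u2 : 3 * (A₁ * (ZS - b₁)) ≤ 3 * (A₁ * (η * b)) := by nlinarith
    have u3 : kStar * ((ZS + WS) - (b₁ + b₂)) ≤ kStar * (η * b) := mul_le_mul_of_nonneg_left hlay hK.le
    have u4 : S * (η * b) ≤ ε / 2 * b := by
      have := mul_le_mul_of_nonneg_right hηS hb0
      linarith [mul_assoc S η b]
    rw [hS] at u4
    linarith
  have hε2 : ε / 2 * b + ε / 2 * (1 + b) ≤ ε * (1 + b₁ + b₂) := by rw [hb]; linarith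
  linarith [hX, hLI, hRB, hsplit, hfrac, hηpart, hε2]

/-- **S2 · FIRST-ORDER IDENTITY AT INFINITY (PROVED).**  The body of `FirstOrderIdentity` (texts of record, VERBATIM), so that the
skeleton's `stub_firstOrderIdentity : Sig.FirstOrderIdentity` is closed by `exact firstOrderIdentity_holds`. -/
theorem firstOrderIdentity_holds : FirstOrderIdentity := by
  intro A A_E V hA1 hAE hV D ε hD hε
  have hVs : ContDiff ℝ (⊤ : ℕ∞) V := hV.2.1
  have hdiv : VectorCalculus.IsDivFree V := hV.2.2.1
  have hV1 : ∀ x, ‖V x‖ ≤ 1 := hV.2.2.2.1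
  have hgr : HasLinearGrowth A_E V := hV.2.2.2.2.2.1
  have hA : ∀ x, ‖fderiv ℝ V x‖ ≤ A 1 := fun x => by rw [← norm_iteratedFDeriv_one]; exact hV.2.2.2.2.1 1 x
  have hA₁0 : 0 ≤ A 1 := (norm_nonneg _).trans (hA 0)
  have hK : 0 < kStar := kStar_pos
  -- constants
  obtain ⟨K, hK0, hcut⟩ := cutoff_package
  obtain ⟨C₀, hC₀0, hC₀⟩ := exists_norm_fderiv_ballCutoff_le
  obtain ⟨Clay, hClay0, hLB⟩ := layer_bound (A₁ := A 1) (K₁ := K 1) (K₂ := K 2) (K₃ := K 3) (C₀ := C₀) (A_E := A_E)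
    (hK0 1) (hK0 2) (hK0 3) hC₀0 hAE.le
  set Crem : ℝ := (2 * A 1 + kStar) * ‖curlCLM‖ * (K 1 * (8 * C₀ * (A_E + 4 * Real.pi / 3)) / Real.pi) * (32 * Real.pi / 3 + 1) / 2 +
    8 * (8 * C₀ * (A_E + 4 * Real.pi / 3)) / Real.pi + K 1 * (8 * C₀ * (A_E + 4 * Real.pi / 3)) / Real.pi +
    3 * kStar * ‖curlCLM‖ * ((2 * K 2 + 8 * K 1) * (8 * C₀ * (A_E + 4 * Real.pi / 3)) / Real.pi) * (32 * Real.pi / 3 + 1) / 2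
    with hCrem
  have hCrem0 : 0 ≤ Crem := by
    have := hK0 1; have := hK0 2; have := norm_nonneg curlCLM; positivity
  set CΘ : ℝ := 11 * (max (max 1 (A 1)) (max kStar ‖curlCLM‖)) ^ 3 * (1 + K 1 + (K 1 + 2 * K 2) + (2 * K 2 + 6 * K 3)) with hCΘ
  have hCΘ0 : 0 ≤ CΘ := by
    have := hK0 1; have := hK0 2; have := hK0 3
    have : 0 ≤ max (max 1 (A 1)) (max kStar ‖curlCLM‖) := le_trans zero_le_one (le_trans (le_max_left _ _) (le_max_left _ _))
    positivity
  -- the choices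
  set η : ℝ := min 1 (ε / (2 * (CΘ + 3 * A 1 + kStar + 1))) with hη
  set ρε : ℝ := 2 * (Clay * (D + 1) + 3 * Crem + 1) / ε with hρε
  set ρ₁ : ℝ := max 2 ρε with hρ₁
  have hρ₁2 : 2 ≤ ρ₁ := le_max_left _ _
  have hρ₁0 : 0 ≤ ρ₁ := by linarith
  refine ⟨η, ρ₁ ^ 8, lt_min one_pos (by positivity), by positivity, ?_⟩
  intro c R hR hDoub hLayer
  -- the scale `ρ = R^{1/8}`
  have hR0 : 0 < R := lt_of_lt_of_le (by positivity) hR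
  set ρ : ℝ := R ^ (1 / 8 : ℝ) with hρdef
  have hρ0 : 0 ≤ ρ := Real.rpow_nonneg hR0.le _
  have hρ8 : ρ ^ 8 = R := by
    have h := Real.rpow_inv_natCast_pow hR0.le (n := 8) (by norm_num)
    norm_num at h
    exact h
  have hρ7 : R ^ (7 / 8 : ℝ) = ρ ^ 7 := by
    rw [hρdef, ← Real.rpow_natCast, ← Real.rpow_mul hR0.le]
    norm_num
  have hρge : ρ₁ ≤ ρ := by
    have h1 : (ρ₁ ^ 8) ^ (1 / 8 : ℝ) ≤ R ^ (1 / 8 : ℝ) := Real.rpow_le_rpow (by positivity) hR (by norm_num)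
    have h2 : (ρ₁ ^ 8) ^ (1 / 8 : ℝ) = ρ₁ := by
      have h := Real.pow_rpow_inv_natCast hρ₁0 (n := 8) (by norm_num)
      norm_num at h
      exact h
    rw [h2] at h1
    exact h1
  have hρ2 : 2 ≤ ρ := le_trans hρ₁2 hρge
  have hρε' : ρε ≤ ρ := le_trans (le_max_right _ _) hρge
  have hρpos : 0 < ρ := by linarith
  have hℓ0 : 0 ≤ ρ ^ 7 := by positivity
  rw [hρ7] at hLayer
  -- the weight
  obtain ⟨χ, hχs, hχc, hχ01, hχ1, hχ0, hχout, hχT, hχS, hk₁, hk₂, hk₁', hk₂', hk₃'⟩ := hcut c ρ hρ2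
  rw [hρ8] at hχ1 hχ0 hχout hχT hχS hk₁ hk₂ hk₁' hk₂' hk₃'
  -- the gauge
  have hC₀R : ∀ y, ‖fderiv ℝ (ballCutoff c (ρ ^ 8)) y‖ ≤ C₀ / ρ ^ 8 := by rw [hρ8]; exact hC₀ c R hR0
  obtain ⟨hψs, -⟩ := gauge_pointwise (c := c) hVs hdiv hV1 hgr hAE.le hR0 hC₀0 (hC₀ c R hR0)
  -- the reduction identity and the layer comparison
  have hred := three_Jg_sub_two_Kg_eq (ψ := biotSavart fun y => ballCutoff c R y • V y) hV hχs hχc isOpen_ball hχ1 hψs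
  have hcmp := abs_three_Jb_sub_le hVs hA hχs.continuous hχ01 hℓ0 hχ1 hχ0
  -- the two `O(1/ρ)` bounds
  have hRB := remainder_bound hA₁0 (hK0 1) (hK0 2) hC₀0 hAE.le hVs hdiv hV1 hgr hA hρ2 hC₀R hχs
    (by rw [hρ8]; exact hχT) (by rw [hρ8]; exact hχS) (by rw [hρ8]; exact hk₁) (by rw [hρ8]; exact hk₂)
  have hLBx := hLB V c ρ χ hVs hdiv hV1 hgr hA hρ2 hC₀R hχs hχ01 (by rw [hρ8]; exact hχout) (by rw [hρ8]; exact hk₁')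
    (by rw [hρ8]; exact hk₂') (by rw [hρ8]; exact hk₃')
  rw [hρ8] at hRB hLBx
  -- doubling and monotonicity
  have hZ4 : Zb V c (4 * R) ≤ D * (Zb V c R + Wb V c R) := by
    have h := hDoub
    unfold IsDoubling at h
    linarith [Wb_nonneg V c (4 * R)]
  have hZS : Zb V c R ≤ Zb V c (R + ρ ^ 7) := Zb_mono hVs (ball_subset_ball (by linarith))
  have hWS : Wb V c R ≤ Wb V c (R + ρ ^ 7) := Wb_mono hVs (ball_subset_ball (by linarith))
  -- assemble
  have hsplit : |3 * Jg χ V - 2 * Kg χ V| ≤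
      |∫ x in (ball c R)ᶜ, (f1 V (fun y => χ y • curl (biotSavart fun y => ballCutoff c R y • V y) y - χ y • V y -
          curl (fun z => χ z • biotSavart (fun y => ballCutoff c R y • V y) z) y) x +
        χ x ^ 2 * (3 * sd V x - kStar * (zd V x + wd V x)))| +
      |a1 kStar 1 V (fun y => χ y • (V y - curl (biotSavart fun y => ballCutoff c R y • V y) y))| := by
    rw [hred]; exact abs_add_le _ _
  have hη1 : η ≤ 1 := min_le_left _ _
  have hηε : η ≤ ε / (2 * (CΘ + 3 * A 1 + kStar + 1)) := min_le_right _ _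
  exact final_arith hε hCΘ0 hClay0 hCrem0 hA₁0 hD.le (Zb_nonneg V c R) (Wb_nonneg V c R) hη1 hηε hρpos hρε' hZS hWS hLayer hZ4
    hLBx hRB (hcmp.trans (by linarith [hsplit]))

end Summit.NavierStokesRegularity.NavierStokesRegularity.Theorems.NearExtremalTransiencePerFlow.TwoThirds

end
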